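import Summits.CriticalPhenomena.CardyFormulaZ2.Theorems.CardyMagicRigidityNestingRigidityNeckZ2HookBig
import HarnessLib

/-!
# Crux `NestingRigidity`, line `pinch-resampling` (v4), stub S12: the covering lemma for `𝔅` on `ℤ²` (small blobs as bridges)

Crux `Summit.CriticalPhenomena.CardyFormulaZ2.Theses.CardyMagicRigidity.NestingRigidity`
(stmt-CriticalPhenomena-4835), line `pinch-resampling` v4, stub S12 `stub_neckHookupCoarseZ2 : NeckHookupCoarseZ2`.
`ℤ²` port of `covering_B` of the S11 road map (`…NestingRigidityNeckCoveringB`, worker S11), on top of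
`…NeckZ2HookBig`: the deterministic, multi-scale core of the estimate of the error part `𝔅 = ZHookR ∖ ZHookBig` (an
HONEST open connection of the two crossing clusters exists, but every such connection meets a SMALL inner-touching
blob: the small blobs are jointly pivotal).

**`NeckCoarseZ2.zCovering_B` (general node form).**  On `ZHookR ∖ ZHookBig` (lattice configuration, `lam + 1 ≤ s`)
there is a nonempty finite family `F` of inner-layer vertices of SMALL blobs — a MINIMAL family whose blobs every open
connection of two given non-`zBigRoute`-connected crossings must meet — such that (a) every blob of `F` is adjacent,
by open edges, to BOTH sides (to a vertex joined to `v`, and to a vertex joined to `v'`, by open paths avoiding the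
blobs of `F`: the "touching necklace" structure), and (b) for EVERY nonempty sub-family `𝒩 ⊆ F` and every inner-layer
centre `w` with the vertices of `𝒩` inside `Λ_Δ(w)` and those of `F ∖ 𝒩` outside `Λ_{Γ-1}(w)`, every square annulus
`zAnn w r R` with `Δ + lam + 1 ≤ r ≤ R`, `R + lam ≤ Γ`, `R + 1 ≤ s` carries the tree's cluster-form four-arm event
`fourArmTwoClustersAt w r R`.  Proof (first entry from each side, as in S11): a connection avoiding `F ∖ 𝒩` exists
(minimality) and must enter an `𝒩`-blob from each side; the two entry points are within `Δ + lam` of `w`, are joined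
through their crossing blobs (big blobs avoid `F`) to the outer layer at sup distance `≥ s - 1 ≥ R` from `w`, and are
not joined inside the annulus (which avoids every blob of `F`).
-/

noncomputable section

namespace Summit.CriticalPhenomena.CardyFormulaZ2.Cruxes.NestingRigidity.PinchResampling

open MeasureTheory Set Literature.Probability.Percolation Literature.Probability.LatticeModels
open ZPinchLocality

namespace NeckCoarseZ2

variable {ℓ lam s : ℕ} {x o : Site 2} {ω : BondConfig (Site 2)}

/-- The big ball minus the blobs of a family of collar vertices. -/
def zAvoid (s : ℕ) (x : Site 2) (ω : BondConfig (Site 2)) (F : Set (Site 2)) : Set (Site 2) :=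
  zBall x (2 * s) \ ⋃ c ∈ F, blobOf (openGraph ω) (zBall x (2 * s) \ zBall x s) c

/-- Restrict an open path to any set containing all points reachable along the way. -/
theorem openPathIn_of_forall_reach {A B : Set (Site 2)} {u v : Site 2} (h : PathIn (openGraph ω) A u v)
    (hB : ∀ z, PathIn (openGraph ω) A u z → z ∈ B) : PathIn (openGraph ω) B u v := by
  obtain ⟨hu, p⟩ := h
  have hu' : u ∈ B := hB u (PathIn.refl hu)
  induction p with
  | refl => exact PathIn.refl hu'
  | @tail y z hyp hyz ih => exact (ih).tail hyz.1 (hB z ⟨hu, hyp.tail hyz⟩)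

/-- Points of a small blob are at sup distance `< lam` of each other. -/
theorem zNorm_sub_lt_of_small {c z z' : Site 2}
    (hsmall : ¬ ∃ w ∈ blobOf (openGraph ω) (zBall x (2 * s) \ zBall x s) c,
      ∃ w' ∈ blobOf (openGraph ω) (zBall x (2 * s) \ zBall x s) c, (lam : ℤ) ≤ zNorm (w - w'))
    (hz : z ∈ blobOf (openGraph ω) (zBall x (2 * s) \ zBall x s) c)
    (hz' : z' ∈ blobOf (openGraph ω) (zBall x (2 * s) \ zBall x s) c) : zNorm (z - z') < lam := by
  by_contra h
  exact hsmall ⟨z, hz, z', hz', not_lt.1 h⟩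

/-- **Covering lemma for `𝔅` on `ℤ²` (general node form; deterministic).**  See the module docstring. -/
theorem zCovering_B (hHG : ∀ a b, (openGraph ω).Adj a b → (zdGraph 2).Adj a b) (hls : lam + 1 ≤ s)
    (hH : ω ∈ ZHookR x s) (hnB : ω ∉ ZHookBig lam s x) :
    ∃ F : Finset (Site 2), (∀ c ∈ F, c ∈ innerLayer (zdGraph 2) (zBall x s) (zBall x (2 * s)) ∧
        ¬ ∃ w ∈ blobOf (openGraph ω) (zBall x (2 * s) \ zBall x s) c,
          ∃ w' ∈ blobOf (openGraph ω) (zBall x (2 * s) \ zBall x s) c, (lam : ℤ) ≤ zNorm (w - w')) ∧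
      F.Nonempty ∧
      (∃ v v' : Site 2, IsCrossing (zdGraph 2) (openGraph ω) (zBall x s) (zBall x (2 * s)) v ∧
        IsCrossing (zdGraph 2) (openGraph ω) (zBall x s) (zBall x (2 * s)) v' ∧
        ¬ PathIn (openGraph ω) (zAvoid s x ω ↑F) v v' ∧
        ∀ c ∈ F, ∃ a₁ c₁ a₂ c₂, PathIn (openGraph ω) (zAvoid s x ω ↑F) v a₁ ∧ (openGraph ω).Adj a₁ c₁ ∧
          c₁ ∈ blobOf (openGraph ω) (zBall x (2 * s) \ zBall x s) c ∧
          PathIn (openGraph ω) (zAvoid s x ω ↑F) v' a₂ ∧ (openGraph ω).Adj a₂ c₂ ∧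
          c₂ ∈ blobOf (openGraph ω) (zBall x (2 * s) \ zBall x s) c) ∧
      ∀ 𝒩 ⊆ F, 𝒩.Nonempty → ∀ (w : Site 2) (Δ r R Γ : ℕ),
        w ∈ innerLayer (zdGraph 2) (zBall x s) (zBall x (2 * s)) →
        (∀ c ∈ 𝒩, zNorm (c - w) ≤ Δ) → (∀ c ∈ F, c ∉ 𝒩 → (Γ : ℤ) ≤ zNorm (c - w)) →
        Δ + lam + 1 ≤ r → r ≤ R → R + lam ≤ Γ → R + 1 ≤ s → ω ∈ fourArmTwoClustersAt w r R := by
  classical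
  set K := zBall x s with hK
  set O := zBall x (2 * s) with hO
  set H := openGraph ω with hH'
  -- two crossings, hooked up but not through the big blobs
  have hvw : ∃ v v', IsCrossing (zdGraph 2) H K O v ∧ IsCrossing (zdGraph 2) H K O v' ∧
      ¬ PathIn H (zBigRoute lam s x ω) v v' := by
    by_contra hcon
    push Not at hcon
    exact hnB fun v v' hv hv' ↦ hcon v v' hv hv'
  obtain ⟨v, v', hv, hv', hnvv'⟩ := hvw
  have hreal : PathIn H O v v' := hH v v' hv hv'
  -- crossings have big blobs meeting the outer layer
  have hbigc : ∀ {v : Site 2}, IsCrossing (zdGraph 2) H K O v →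
      (∃ w₁ ∈ blobOf H (O \ K) v, ∃ w₂ ∈ blobOf H (O \ K) v, (lam : ℤ) ≤ zNorm (w₁ - w₂)) ∧
      (∃ w₁ ∈ blobOf H (O \ K) v, w₁ ∈ outerLayer (zdGraph 2) K O) := fun hv ↦
    big_and_crossing_of_isCrossing hls hv
  -- the universe of small inner-touching blob vertices, and the avoidance property
  let Sm : Set (Site 2) := {c | c ∈ innerLayer (zdGraph 2) K O ∧
    ¬ ∃ w ∈ blobOf H (O \ K) c, ∃ w' ∈ blobOf H (O \ K) c, (lam : ℤ) ≤ zNorm (w - w')}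
  have hfin : Sm.Finite := (zBall_finite x (2 * s)).subset fun c hc ↦ hc.1.1.1
  set U : Finset (Site 2) := hfin.toFinset with hU
  have hUS : (↑U : Set (Site 2)) = Sm := by simp [hU]
  let P : Finset (Site 2) → Prop := fun F ↦ ¬ PathIn H (zAvoid s x ω ↑F) v v'
  have hPU : P U := by
    intro hp
    change PathIn H (O \ ⋃ c ∈ (↑U : Set (Site 2)), blobOf H (O \ K) c) v v' at hp
    rw [hUS] at hp
    exact hnvv' (pathIn_zBigRoute_of_avoid hHG hv (hbigc hv).1 hp).1
  set 𝒞 := U.powerset.filter P with h𝒞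
  have hU𝒞 : U ∈ 𝒞 := Finset.mem_filter.2 ⟨Finset.mem_powerset.2 subset_rfl, hPU⟩
  obtain ⟨F, hF𝒞, hFmin⟩ := Finset.exists_min_image 𝒞 Finset.card ⟨U, hU𝒞⟩
  obtain ⟨hFU, hFP⟩ := Finset.mem_filter.1 hF𝒞
  have hFU' : ∀ c ∈ F, c ∈ Sm := fun c hc ↦ by
    have := Finset.mem_powerset.1 hFU hc
    simpa [hU] using this
  have hmin : ∀ 𝒩 ⊆ F, 𝒩.Nonempty → PathIn H (zAvoid s x ω ↑(F \ 𝒩)) v v' := by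
    intro 𝒩 h𝒩 hne
    by_contra hch
    have hmem : F \ 𝒩 ∈ 𝒞 :=
      Finset.mem_filter.2 ⟨Finset.mem_powerset.2 (Finset.sdiff_subset.trans (Finset.mem_powerset.1 hFU)), hch⟩
    have h1 := hFmin _ hmem
    have h2 : (F \ 𝒩).card < F.card := by
      obtain ⟨e, he⟩ := hne
      exact Finset.card_lt_card (Finset.sdiff_ssubset h𝒩 ⟨e, he⟩)
    omega
  -- big blobs avoid the family; in particular the crossing blobs do
  have hbig_avoid : ∀ {u z : Site 2}, (∃ w₁ ∈ blobOf H (O \ K) u, ∃ w₂ ∈ blobOf H (O \ K) u, (lam : ℤ) ≤ zNorm (w₁ - w₂)) →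
      z ∈ blobOf H (O \ K) u → z ∈ zAvoid s x ω ↑F := by
    intro u z hbig hz
    refine ⟨(PathIn.right_mem hz).1, fun hz' ↦ ?_⟩
    simp only [mem_iUnion, Finset.mem_coe, exists_prop] at hz'
    obtain ⟨c, hc, hzc⟩ := hz'
    have hcu : blobOf H (O \ K) c = blobOf H (O \ K) u :=
      (NeckCoarse.blobOf_eq_of_mem hzc).symm.trans (NeckCoarse.blobOf_eq_of_mem hz)
    refine (hFU' c hc).2 ?_
    rw [hcu]; exact hbig
  have memU : ∀ (S : Set (Site 2)) (z : Site 2),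
      z ∈ (⋃ c ∈ S, blobOf H (O \ K) c) ↔ ∃ c ∈ S, z ∈ blobOf H (O \ K) c := fun S z ↦ by
    simp only [mem_iUnion, exists_prop]
  -- `zAvoid F` is `zAvoid (F ∖ 𝒩)` minus the `𝒩`-blobs
  have hsplit : ∀ (𝒩 : Finset (Site 2)),
      (⋃ c ∈ (↑𝒩 : Set (Site 2)), blobOf H (O \ K) c)ᶜ ∩ zAvoid s x ω ↑(F \ 𝒩) ⊆ zAvoid s x ω ↑F := by
    rintro 𝒩 z ⟨hzN, hzO, hzFN⟩
    refine ⟨hzO, fun hzF ↦ ?_⟩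
    obtain ⟨c, hc, hzc⟩ := (memU _ z).1 hzF
    by_cases hcN : c ∈ 𝒩
    · exact hzN ((memU _ z).2 ⟨c, Finset.mem_coe.2 hcN, hzc⟩)
    · exact hzFN ((memU _ z).2 ⟨c, Finset.mem_coe.2 (Finset.mem_sdiff.2 ⟨Finset.mem_coe.1 hc, hcN⟩), hzc⟩)
  have hside : ∀ (𝒩 : Finset (Site 2)), 𝒩 ⊆ F → ∀ {c₀ c₁ : Site 2}, IsCrossing (zdGraph 2) H K O c₀ →
      PathIn H (zAvoid s x ω ↑(F \ 𝒩)) c₀ c₁ → ¬ PathIn H (zAvoid s x ω ↑F) c₀ c₁ →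
      ∃ a cc, PathIn H (zAvoid s x ω ↑F) c₀ a ∧ H.Adj a cc ∧
        ∃ c ∈ 𝒩, cc ∈ blobOf H (O \ K) c := by
    intro 𝒩 h𝒩 c₀ c₁ hc₀ hp hn
    have hc₀R : c₀ ∈ (⋃ c ∈ (↑𝒩 : Set (Site 2)), blobOf H (O \ K) c)ᶜ := by
      intro h0
      obtain ⟨c, hc, h⟩ := (memU _ c₀).1 h0
      exact (hbig_avoid (hbigc hc₀).1 (NeckCoarse.self_mem_blobOf hc₀.1.1)).2
        ((memU _ c₀).2 ⟨c, Finset.mem_coe.2 (h𝒩 (Finset.mem_coe.1 hc)), h⟩)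
    rcases hp.exit_or (R := (⋃ c ∈ (↑𝒩 : Set (Site 2)), blobOf H (O \ K) c)ᶜ) hc₀R with
      hstay | ⟨a, cc, -, hccR, -, hadj, hpref⟩
    · exact (hn (hstay.mono (hsplit 𝒩))).elim
    · refine ⟨a, cc, hpref.mono (hsplit 𝒩), hadj, ?_⟩
      simp only [mem_compl_iff, not_not] at hccR
      obtain ⟨c, hc, hcc⟩ := (memU _ cc).1 hccR
      exact ⟨c, Finset.mem_coe.1 hc, hcc⟩
  refine ⟨F, fun c hc ↦ hFU' c hc, ?_, ⟨v, v', hv, hv', hFP, fun c hc ↦ ?_⟩, ?_⟩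
  · by_contra hemp
    rw [Finset.not_nonempty_iff_eq_empty] at hemp
    refine hFP (hreal.mono fun z hz ↦ ⟨hz, ?_⟩)
    simp [hemp]
  · -- every family blob is adjacent to both sides
    have hsub : ({c} : Finset (Site 2)) ⊆ F := Finset.singleton_subset_iff.2 hc
    have hρ := hmin {c} hsub ⟨c, Finset.mem_singleton_self c⟩
    obtain ⟨a₁, c₁, hpa₁, hadj₁, k₁, hk₁, hc₁⟩ := hside {c} hsub hv hρ hFP
    obtain ⟨a₂, c₂, hpa₂, hadj₂, k₂, hk₂, hc₂⟩ := hside {c} hsub hv' hρ.symm fun h ↦ hFP h.symm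
    rw [Finset.mem_singleton] at hk₁ hk₂
    subst hk₁; subst hk₂
    exact ⟨a₁, c₁, a₂, c₂, hpa₁, hadj₁, hc₁, hpa₂, hadj₂, hc₂⟩
  intro 𝒩 h𝒩 hne w Δ r R Γ hw hΔ hΓ hr hrR hRΓ hRs
  -- the annulus avoids the family
  have hAnn : zAnn w r R ⊆ zAvoid s x ω ↑F := by
    intro z hz
    refine ⟨zAnn_subset_zBall hw hRs hz, fun hz' ↦ ?_⟩
    simp only [mem_iUnion, Finset.mem_coe, exists_prop] at hz'
    obtain ⟨c, hc, hzc⟩ := hz'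
    have hd := zNorm_sub_lt_of_small (hFU' c hc).2 hzc (NeckCoarse.self_mem_blobOf (hFU' c hc).1.1)
    have h1 := zNorm_sub_le_add z c w
    have h2 := zNorm_sub_le_add c z w
    have h3 : zNorm (c - z) = zNorm (z - c) := zNorm_sub_comm _ _
    obtain ⟨hzr, hzR⟩ := hz
    by_cases hcN : c ∈ 𝒩
    · have := hΔ c hcN; omega
    · have := hΓ c hc hcN; omega
  -- a connection avoiding `F ∖ 𝒩` exists and must enter an `𝒩`-blob: first entry from each side
  have hρ := hmin 𝒩 h𝒩 hne
  obtain ⟨a₁, c₁, hpa₁, hadj₁, k₁, hk₁, hc₁⟩ := hside 𝒩 h𝒩 hv hρ hFP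
  obtain ⟨a₂, c₂, hpa₂, hadj₂, k₂, hk₂, hc₂⟩ := hside 𝒩 h𝒩 hv' hρ.symm fun h ↦ hFP h.symm
  -- the two sides are not connected inside the avoiding set
  have hn12 : ¬ PathIn H (zAvoid s x ω ↑F) a₁ a₂ := fun h ↦ hFP ((hpa₁.trans h).trans hpa₂.symm)
  -- near
  have hnear : ∀ {a cc k : Site 2}, H.Adj a cc → k ∈ 𝒩 → cc ∈ blobOf H (O \ K) k → zNorm (a - w) < r := by
    intro a cc k hadj hk hcc
    have h1 : zNorm (a - cc) ≤ 1 := by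
      have := zNorm_sub_le_of_adj (hHG _ _ hadj).symm cc
      have h0 : zNorm (cc - cc) = 0 := by simp [zNorm]
      omega
    have h2 := zNorm_sub_lt_of_small (hFU' k (h𝒩 hk)).2 hcc (NeckCoarse.self_mem_blobOf (hFU' k (h𝒩 hk)).1.1)
    have h3 := hΔ k hk
    have h4 := zNorm_sub_le_add a cc w
    have h5 := zNorm_sub_le_add cc k w
    omega
  -- far: through the crossing blob to the outer layer
  have hfar : ∀ {c₀ a : Site 2}, IsCrossing (zdGraph 2) H K O c₀ → PathIn H (zAvoid s x ω ↑F) c₀ a →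
      ∃ q, PathIn H (zAvoid s x ω ↑F) a q ∧ (R : ℤ) ≤ zNorm (q - w) := by
    intro c₀ a hc₀ hp
    obtain ⟨hbig, q, hq, hqo⟩ := hbigc hc₀
    refine ⟨q, hp.symm.trans (openPathIn_of_forall_reach hq fun z hz ↦ hbig_avoid hbig hz), ?_⟩
    have h1 := zNorm_eq_of_mem_outerLayer hqo
    have h2 := zNorm_eq_of_mem_innerLayer hw
    have h3 := zNorm_sub_le_add q w x
    omega
  obtain ⟨q₁', ha₁q, hq₁R⟩ := hfar hv hpa₁
  obtain ⟨q₂', ha₂q, hq₂R⟩ := hfar hv' hpa₂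
  obtain ⟨p₁, q₁, hp₁, hq₁, hcross₁, ha₁p₁⟩ := exists_zAnn_crossing_of_pathIn hHG hrR (hnear hadj₁ hk₁ hc₁) hq₁R ha₁q
  obtain ⟨p₂, q₂, hp₂, hq₂, hcross₂, ha₂p₂⟩ := exists_zAnn_crossing_of_pathIn hHG hrR (hnear hadj₂ hk₂ hc₂) hq₂R ha₂q
  refine mem_fourArmTwoClustersAt_of_crossings (by omega) hrR hp₁ hq₁ hp₂ hq₂ (hcross₁.mono inter_subset_right)
    (hcross₂.mono inter_subset_right) fun h12 ↦ hn12 ?_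
  exact ha₁p₁.trans ((h12.mono hAnn).trans ha₂p₂.symm)

end NeckCoarseZ2

/-- **Covering lemma for `𝔅` on `ℤ²`, node form (registered helper, anchor of this module on the crux item)**: see
`NeckCoarseZ2.zCovering_B` and the module docstring (the touching-necklace clause is dropped here). -/
theorem zCovering_B_nodes : ∀ (lam s : ℕ) (x : Site 2) (ω : BondConfig (Site 2)), (∀ a b, (openGraph ω).Adj a b → (zdGraph 2).Adj a b) → lam + 1 ≤ s → ω ∈ ZHookR x s → ω ∉ ZHookBig lam s x → ∃ F : Finset (Site 2), (∀ c ∈ F, c ∈ innerLayer (zdGraph 2) (zBall x s) (zBall x (2 * s)) ∧ ¬ ∃ w ∈ blobOf (openGraph ω) (zBall x (2 * s) \ zBall x s) c, ∃ w' ∈ blobOf (openGraph ω) (zBall x (2 * s) \ zBall x s) c, (lam : ℤ) ≤ zNorm (w - w')) ∧ F.Nonempty ∧ ∀ 𝒩 ⊆ F, 𝒩.Nonempty → ∀ (w : Site 2) (Δ r R Γ : ℕ), w ∈ innerLayer (zdGraph 2) (zBall x s) (zBall x (2 * s)) → (∀ c ∈ 𝒩, zNorm (c - w) ≤ Δ)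 → (∀ c ∈ F, c ∉ 𝒩 → (Γ : ℤ) ≤ zNorm (c - w)) → Δ + lam + 1 ≤ r → r ≤ R → R + lam ≤ Γ → R + 1 ≤ s → ω ∈ fourArmTwoClustersAt w r R := by
  intro lam s x ω hHG hls hH hnB
  obtain ⟨F, hF, hne, -, hnode⟩ := NeckCoarseZ2.zCovering_B hHG hls hH hnB
  exact ⟨F, hF, hne, hnode⟩

end Summit.CriticalPhenomena.CardyFormulaZ2.Cruxes.NestingRigidity.PinchResampling

end
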